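import Summits.QuantumFields.YangMills.Theorems.BalabanUVNodesN15VectorPieceMixed
import Summits.QuantumFields.YangMills.Theorems.BalabanUVNodesN15VectorPieceBackground
import Summits.QuantumFields.YangMills.Theorems.BalabanUVNodesN15BackgroundLayerFirstOrderFull
import Summits.QuantumFields.YangMills.Theorems.BalabanUVNodesN15BackgroundGaugeByName
import HarnessLib

/-!
# Route «BalabanUVNodes» (K4 «SpineRates»), node N15 = NE2 — THE FIRST-ORDER JOINT -a∕-b KNIT: `T4EtaRate.NE2PlusOperator` BY NAME for the U = 1 vector
# single-scale piece DRESSED BY THE FIRST-ORDER BACKGROUND SPECIES `V = M_c + Σ_μ M_{a_μ}∘∇_μ` — background block LIVE ((3.35) consumed on every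
# coefficient), size guard LIVE, all four (3.42) entries CONSTRUCTED, EVERY U ≡ 1 input (the twelve hypothesis families of B4∕C2) a tree theorem;
# and the same with the (abelian) GAUGE FIELD `A′` LIVE (n15-b C2 instantiated)

Cell `pub-ymgap`, seat `pub-ymgap-dag-n15-c` (generation g0; R134 ACCELERATION SEAT, strategy s1; HUMAN RULING D-0062; chair R424 venue; `bears_on: R4∕N15`).
Filed `--supports stmt-QuantumFields-19676` (K3 «SpineGivenEndpointR11»; helper).  Plumbing: the level-`n` mixed piece builder `pieceM`, the realised first-order
background instance ∕ family (`bgVecInstance₁`, `bgVecFamily₁4`); then theorems.  Imports BY NAME, nothing in the tree modified: this seat's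
`…VectorPieceMixed` (`hasMaj_mixedEntries`, `hasMaj_plainMixed_all`; transitively `…DefectKernelVectorPieceMixed`), n15-a part 27 `…VectorPieceBackground`
(`unitTorusGeoS`, `unitTorusGeoS_L_ne_zero`, `pieceG`∕`pieceD1`∕`pieceS`∕`pieceD3`, `thetaV`, `uniform_layer_vectorPiece`; transitively parts 26∕25∕23∕16∕15:
`hasMaj_plain_all`, `VecIndexS`, `hasMaj_threeEntries`, the plumbing `reH`∕`reD`∕`covC`∕`wTranspose`∕`rweight`∕`blkFine`∕`kingPrV`), n15-b part B4
`…BackgroundLayerFirstOrderFull` (`…N15.BackgroundLayer.ne2PlusOperator_background₁4`, `bgInstance₁`, `bgFamily₁4`; transitively B1–B3: `coeffBg₁`, `bgPair`,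
`bgSourceV`, `bgDerivedV`, `stack`, `unstack`) and parts C1∕C2 `…BackgroundGaugeByName` (`gaugeInstance`, `gaugeFamily4`, `ne2PlusOperator_gauge`).

WHAT THIS IS (n15-a ACK-N15C, pub-ymgap INBOX l.12020: «The first-order joint knit (n15-b B4 `…background₁4` at the -a data) then follows part 27's pattern …
whoever of us three is seated when both inputs are in the tree takes it»).  n15-b's B4 proves `NE2PlusOperator` BY NAME for ANY family of data whose only
displayed hypotheses are the `U ≡ 1` LAYER of the first-order species: seven plain majorants `β·e^{−δd}` (coarse `G`, `∇_μG` (all `μ`), `S = G∇_ν*`,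
`SD_μ = ∇_μG∇_ν*` (all `μ`); fine `G′`, `∇′_μG′` (all `μ`), `D₃′ = (Δ′−∂′∂′*)G′`) and five η-defects `m₀·θ·e^{−δd}` (`𝔇(G′,G)`, `𝔇(∇′_μG′,∇_μG)` (all `μ`),
`𝔇(S′,S)`, `𝔇(SD′_μ,SD_μ)` (all `μ`), `𝔇(D₃′,D₃)`) with `θ ≤ (L^j)^{−γ}`.  For the U = 1 vector single-scale piece `G = H_k·C^{(k)}·(η^{d+1}H_kᵀ)` on the unit-torus
carrier these are ALL tree theorems: plain = n15-a part 26 (`G`, `G′`, `S`, `∇′_νG′`, `D₃′`) + this seat's `hasMaj_plainMixed_all` (coarse `∇_μG`, coarse∕fine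
mixed); defects = n15-a parts 15∕16∕23 (entries 0–3, `hasMaj_threeEntries` for every direction) + this seat's `hasMaj_mixedEntries` (the mixed pair, every
direction pair).  THIS FILE PLUGS THEM IN, exactly as part 27 did for the zeroth-order species (A4).  Data of the realised family, index `j : VecIndexS d L`:
sized carrier `unitTorusGeoS L j.k j.Mn j.Msz` (the fine instance's [B9] size parameter IS `j.Msz` — `bgVecInstance₁_gf_M`; guard and smallness LIVE, `M`
inside the (3.35) letters of EVERY coefficient `c′, a′_μ` of the carrier `coeffBg₁`), blocks `blkFine`, King's pairing `kingPrV`, scale shift `m`, rate number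
`θ_j = (L^k)^{−¼}` (`γ = ¼`: entries 1∕2 and the mixed pair at `α = γ = ½`, entries 0∕3 the full `(L^k)⁻¹ ≤ (L^k)^{−¼}`), direction `j.ν` for the derived
component read out (entry 1) and for the source `S = G∇_ν*`; directions `J = Fin (d + 1)` for the first-order coefficients and the stacks.

CONTENTS.
* §1 `pieceM` (the level-`n` mixed piece `(∂_μH)·C^{(kk)}·(w·(∂_νH)ᵀ)`), `bgVecInstance₁`, `bgVecFamily₁4`, **`bgVecInstance₁_gf_M`** (`rfl`: guard = `j.Msz`,
  LIVE), `reg335_bgVec₁_iff` (what (3.35) says here: sup AND oscillation letter on `c′` and on every `a′_μ`).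
* §2 **`uniform_layer_firstOrder`**: ONE `(β, δ, m₀)` with `0 < δ` such that all seven plain majorants (every `μ`) and all five defects (every `μ`) hold at every
  sized index (parts 26∕15∕16∕23 + this seat's two mixed-piece theorems read at the common rate).
* §3 **`ne2PlusOperator_vectorPiece_background₁`**: for `d + 1 ≥ 2`, `L ≥ 1` and every `c₃₅ > 0`,
  `T4EtaRate.NE2PlusOperator c₃₅ (bgVecInstance₁ hL) (bgVecFamily₁4 hL)` — B4 instantiated; `_dim4`.
* §4 `gaugeVecInstance`, `gaugeVecFamily4`, `gaugeVecInstance_gf_M`, `reg335_gaugeVec_iff`; **`ne2PlusOperator_vectorPiece_gauge`**: the same layer feeds n15-b's C2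
  `ne2PlusOperator_gauge` — `NE2PlusOperator c₃₅ (gaugeVecInstance hL) (gaugeVecFamily4 hL)`, the (abelian) GAUGE FIELD `A′` LIVE, (3.35) consumed on `A′`
  itself (the rate number `θ_j = (L^k)^{−¼} ≥ η = L^{−k}`, `η ≤ 1`); `_dim4`.

HONEST FRAMING ∕ LIMITS.  A knit: no new estimate (every analytic input is a landed theorem of the -a∕-b∕-c chains).  What the statement covers: the LINEAR (U = 1)
vector piece of [B5]∕[B6]∕King (4.42) dressed by n15-b's FIRST-ORDER abelian coefficient species `V = M_c + Σ_μ M_{a_μ}∘∇_μ` of [B9] (3.50)–(3.53) (scalar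
coefficients, the print's (3.52) SHAPE) with linearised block-average transport, through the stacked Neumann device (B1b) — NOT Bałaban's full non-abelian `G(U)`
(matrix coefficients through `ad`, the (C3) nonlinear transport, the multiscale carrier of NODE 00: NE2⁺ for `G(U)` beyond this model NOT PRINTED ∕ not proved);
one single-scale piece, NOT the telescoping over `j`.  Count-neutral (typed 28∕28 · discharged unchanged); NOT a discharge of N15; one finite T⁴ at fixed ε — NOT
infinite volume, NOT OS on ℝ⁴, NOT a mass gap, NOT Clay.
-/

noncomputable section

open scoped BigOperators
open Finset

namespace Summit.QuantumFields.YangMills.BalabanUVNodes.N15.VectorPiece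

open Literature.MathematicalPhysics.QuantumFieldTheory.Balaban1983to89
open Literature.MathematicalPhysics.QuantumFieldTheory.Balaban1983to89.B11SectG (BlockNorm HasMaj RowSum)
open Literature.MathematicalPhysics.QuantumFieldTheory.Balaban1983to89.B6RandomWalk (Triangle254)
open Literature.MathematicalPhysics.QuantumFieldTheory.Balaban1983to89.T4EtaRate (PairedInstance NE2PlusOperator)
open Literature.MathematicalPhysics.QuantumFieldTheory.Balaban1983to89.T4EtaRateDefect (idef rateWeight)
open Literature.MathematicalPhysics.QuantumFieldTheory.Balaban1983to89.T4EtaRateCoeffDefect (pull FibreOsc)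
open Literature.MathematicalPhysics.QuantumFieldTheory.Balaban1983to89.B5Prop11Plancherel (Tor fine)
open Literature.MathematicalPhysics.QuantumFieldTheory.Balaban1983to89.B6UnitTorusCarrier (unitTorusGeo unitTorusGeo_len triangle254_unitTorusGeo
  rowSum_unitTorusGeo)
open Literature.MathematicalPhysics.QuantumFieldTheory.King1986.Torus (tdistT tdistT_nonneg)
open Summit.QuantumFields.YangMills.BalabanUVNodes.N15.BackgroundLayer (coeffBg₁ bgInstance₁ bgFamily₁4 ne2PlusOperator_background₁4 gaugeBg
  gaugeInstance gaugeFamily4 ne2PlusOperator_gauge)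

variable {d : ℕ}

/-! ## §1 The mixed piece builder and the realised first-order background instance family -/

section Data

variable (L : ℕ) (M : Fin (d + 1) → ℕ) [∀ μ, NeZero (M μ)] (n kk : ℕ) [NeZero n] (w : ℝ)

/-- THE LEVEL-`n` MIXED PIECE `∇_μG∇_ν* = (∂_μH)·C^{(kk)}·(w·(∂_νH)ᵀ)` (left factor the typed derivative in direction `μ`, right factor the Riemann-weighted
transpose of the typed derivative in direction `ν`; `n = L^k`, `w = η^{d+1}` coarse; `n = L^mL^k`, `w = η^{d+1}∕(L^m)^{d+1}` fine).
[cite: Balaban1985BackgroundPropagators, (3.44) p.397 (the mixed entry, shape); King1986, (4.42) p.675 (the piece); Balaban1984PropagatorsI, (1.63) p.28] -/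
def pieceM (μ ν : Fin (d + 1)) : (Tor (fine n M) × Fin (d + 1) → ℝ) →ₗ[ℝ] (Tor (fine n M) × Fin (d + 1) → ℝ) :=
  reD M n μ ∘ₗ (covC L M (L ^ kk) ∘ₗ wTranspose M n w (reD M n ν))

end Data

section Family

variable (L : ℕ) [NeZero L]

/-- THE REALISED FIRST-ORDER BACKGROUND INSTANCE at a sized index: n15-b's `bgInstance₁` (directions `J = Fin (d + 1)`) over the SIZED unit-torus carrier,
blocks `blkFine`, King's pairing, scale shift `m`, rate number `θ_j` (coarse and fine first-order coefficient carriers `coeffBg₁` = the (3.35) letter pair on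
`c′` and on every `a′_μ`, with the index's `M`). [cite: Balaban1985BackgroundPropagators, Thm 3.14 pp.426–427 (typing template); (3.35) p.396; (3.52) p.400 (the first-order shape)] -/
def bgVecInstance₁ (hL : 1 ≤ L) (j : VecIndexS d L) : PairedInstance :=
  bgInstance₁ (Fin (d + 1)) (g := unitTorusGeoS L j.k j.Mn j.Msz) (blkFine L j.k j.Mn) (kingPrV L j.k j.m j.Mn) j.m (unitTorusGeoS_L_ne_zero L hL j)
    (thetaV L j) (thetaV L j)

/-- THE REALISED FIRST-ORDER KERNEL FAMILY: n15-b's `bgFamily₁4` (all four (3.42) entries of the first-order background-dependent pair CONSTRUCTED over the stacked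
space `X × Option J` by the fixed-point equation (3.65), B1–B3) fed with the -a pieces of the vector single-scale piece at the index: `G`, `S = G∂_ν*`,
`D₃ = (Δ−∂∂*)G`, `D_μ = ∂_μG` (all `μ`), `SD_μ = ∂_μG∂_ν*` (all `μ`) at both spacings (direction `ν = j.ν`).
[cite: Balaban1985BackgroundPropagators, (3.42) + (3.44) p.397, (3.52) p.400, (3.63)–(3.65) pp.402–403 (shapes, mechanism)] -/
def bgVecFamily₁4 (hL : 1 ≤ L) (j : VecIndexS d L) : B9.KernelFamily (bgVecInstance₁ (d := d) L hL j).gc (bgVecInstance₁ (d := d) L hL j).Bf :=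
  bgFamily₁4 (g := unitTorusGeoS L j.k j.Mn j.Msz) (blkFine L j.k j.Mn) (kingPrV L j.k j.m j.Mn) j.m (unitTorusGeoS_L_ne_zero L hL j) (thetaV L j) (thetaV L j)
    j.ν
    (pieceG L j.Mn (L ^ j.k) j.k (rweight (d := d) L j.k)) (pieceS L j.Mn (L ^ j.k) j.k (rweight (d := d) L j.k) j.ν)
    (pieceD3 L j.Mn (L ^ j.k) j.k (rweight (d := d) L j.k))
    (fun μ => pieceD1 L j.Mn (L ^ j.k) j.k (rweight (d := d) L j.k) μ) (fun μ => pieceM L j.Mn (L ^ j.k) j.k (rweight (d := d) L j.k) μ j.ν)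
    (pieceG L j.Mn (L ^ j.m * L ^ j.k) (j.k + j.m) (rweight (d := d) L j.k / ((L : ℝ) ^ j.m) ^ (d + 1)))
    (pieceS L j.Mn (L ^ j.m * L ^ j.k) (j.k + j.m) (rweight (d := d) L j.k / ((L : ℝ) ^ j.m) ^ (d + 1)) j.ν)
    (pieceD3 L j.Mn (L ^ j.m * L ^ j.k) (j.k + j.m) (rweight (d := d) L j.k / ((L : ℝ) ^ j.m) ^ (d + 1)))
    (fun μ => pieceD1 L j.Mn (L ^ j.m * L ^ j.k) (j.k + j.m) (rweight (d := d) L j.k / ((L : ℝ) ^ j.m) ^ (d + 1)) μ)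
    (fun μ => pieceM L j.Mn (L ^ j.m * L ^ j.k) (j.k + j.m) (rweight (d := d) L j.k / ((L : ℝ) ^ j.m) ^ (d + 1)) μ j.ν)

/-- **THE GUARD IS LIVE**: the fine realised first-order instance's [B9] size parameter IS the index's `M` (n15-b's `bgInstance₁_M` on the sized carrier) — and
the index family has unbounded `M` (part 25 `exists_vecIndexS_size_ge`). [folklore] -/
theorem bgVecInstance₁_gf_M (hL : 1 ≤ L) (j : VecIndexS d L) : (bgVecInstance₁ (d := d) L hL j).gf.M = j.Msz := rfl

/-- WHAT (3.35) SAYS HERE: a fine first-order coefficient family `U = (c′, (a′_μ)_μ)` is `Reg335 c₃₅ α₀`-regular iff `|c′|, |a′_μ| ≤ c₃₅·M·α₀` pointwise and the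
oscillation of `c′` and of every `a′_μ` over every King fibre is `≤ c₃₅·M·α₀·θ_j` — the printed letter pair «|A| < O(1)Mα₀(L^jη)^{−1}, |∇^ηA| < O(1)Mα₀(L^jη)^{−2}
on □» read blockwise on EVERY coefficient of `V′ = M_{c′} + Σ_μ M_{a′_μ}∘∇′_μ`, with the index's OWN `M`. [cite: Balaban1985BackgroundPropagators, (3.35) p.396, (3.52) p.400] -/
theorem reg335_bgVec₁_iff (hL : 1 ≤ L) (j : VecIndexS d L) (c35 α₀ : ℝ)
    (U : (Tor (fine (L ^ j.m * L ^ j.k) j.Mn) × Fin (d + 1) → ℝ) × (Fin (d + 1) → Tor (fine (L ^ j.m * L ^ j.k) j.Mn) × Fin (d + 1) → ℝ)) :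
    (bgVecInstance₁ (d := d) L hL j).Bf.Reg335 c35 α₀ U ↔
      ((∀ x', |U.1 x'| ≤ c35 * j.Msz * α₀) ∧ ∀ μ x', |U.2 μ x'| ≤ c35 * j.Msz * α₀) ∧
        (FibreOsc (kingPrV L j.k j.m j.Mn) U.1 (fun _ => c35 * j.Msz * α₀ * thetaV L j) ∧
          ∀ μ, FibreOsc (kingPrV L j.k j.m j.Mn) (U.2 μ) (fun _ => c35 * j.Msz * α₀ * thetaV L j)) :=
  Iff.rfl

end Family

/-! ## §2 The U ≡ 1 layer of the first-order species at ONE uniform `(β, δ, m₀)`, on the sized carriers -/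

section Layer

variable {L : ℕ} [NeZero L]

/-- **THE UNIFORM U ≡ 1 LAYER OF THE FIRST-ORDER SPECIES.**  For `d + 1 ≥ 2`, `L ≥ 1` there are `β, δ, m₀ > 0` such that at every sized index `j` (direction
`ν = j.ν`): the seven plain majorants `β·e^{−δ|y−y′|_T}` of `G`, `∂_μG` (all `μ`), `G′`, `∂′_μG′` (all `μ`), `G∂_ν*`, `∂_μG∂_ν*` (all `μ`), `(Δ′−∂′∂′*)G′` (n15-a part 26 +
this seat's `hasMaj_plainMixed_all`) and the five η-defects `m₀·θ_j·e^{−δ|y−y′|_T}` of `(G′,G)`, `(∂′_μG′,∂_μG)` (all `μ`), `(G′∂′_ν*,G∂_ν*)`, `(∂′_μG′∂′_ν*,∂_μG∂_ν*)`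
(all `μ`), `((Δ′−∂′∂′*)G′,(Δ−∂∂*)G)` (n15-a parts 15∕16∕23 + this seat's `hasMaj_mixedEntries`, read at `θ_j = (L^k)^{−¼}`) hold on the sized carrier — all
twelve families at ONE decay rate. [cite: King1986, (4.42)–(4.43) p.675 (mechanism); Balaban1985BackgroundPropagators, (3.42) + (3.44) p.397 (shapes)] -/
theorem uniform_layer_firstOrder (hd : 1 ≤ d) (hL : 1 ≤ L) :
    ∃ β δ m₀ : ℝ, 0 < β ∧ 0 < δ ∧ 0 < m₀ ∧ ∀ j : VecIndexS d L,
      HasMaj (BlockNorm.ofBlocks (unitTorusGeoS L j.k j.Mn j.Msz) (blkFine L j.k j.Mn)) (BlockNorm.ofBlocks (unitTorusGeoS L j.k j.Mn j.Msz) (blkFine L j.k j.Mn))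
          (pieceG L j.Mn (L ^ j.k) j.k (rweight (d := d) L j.k)) (fun y y' => β * Real.exp (-(δ * (unitTorusGeoS L j.k j.Mn j.Msz).dist y y')))
      ∧ (∀ μ, HasMaj (BlockNorm.ofBlocks (unitTorusGeoS L j.k j.Mn j.Msz) (blkFine L j.k j.Mn))
          (BlockNorm.ofBlocks (unitTorusGeoS L j.k j.Mn j.Msz) (blkFine L j.k j.Mn))
          (pieceD1 L j.Mn (L ^ j.k) j.k (rweight (d := d) L j.k) μ) (fun y y' => β * Real.exp (-(δ * (unitTorusGeoS L j.k j.Mn j.Msz).dist y y'))))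
      ∧ HasMaj (BlockNorm.ofBlocks (unitTorusGeoS L j.k j.Mn j.Msz) (blkFine L j.k j.Mn ∘ kingPrV L j.k j.m j.Mn))
          (BlockNorm.ofBlocks (unitTorusGeoS L j.k j.Mn j.Msz) (blkFine L j.k j.Mn ∘ kingPrV L j.k j.m j.Mn))
          (pieceG L j.Mn (L ^ j.m * L ^ j.k) (j.k + j.m) (rweight (d := d) L j.k / ((L : ℝ) ^ j.m) ^ (d + 1)))
          (fun y y' => β * Real.exp (-(δ * (unitTorusGeoS L j.k j.Mn j.Msz).dist y y')))
      ∧ (∀ μ, HasMaj (BlockNorm.ofBlocks (unitTorusGeoS L j.k j.Mn j.Msz) (blkFine L j.k j.Mn ∘ kingPrV L j.k j.m j.Mn))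
          (BlockNorm.ofBlocks (unitTorusGeoS L j.k j.Mn j.Msz) (blkFine L j.k j.Mn ∘ kingPrV L j.k j.m j.Mn))
          (pieceD1 L j.Mn (L ^ j.m * L ^ j.k) (j.k + j.m) (rweight (d := d) L j.k / ((L : ℝ) ^ j.m) ^ (d + 1)) μ)
          (fun y y' => β * Real.exp (-(δ * (unitTorusGeoS L j.k j.Mn j.Msz).dist y y'))))
      ∧ HasMaj (BlockNorm.ofBlocks (unitTorusGeoS L j.k j.Mn j.Msz) (blkFine L j.k j.Mn)) (BlockNorm.ofBlocks (unitTorusGeoS L j.k j.Mn j.Msz) (blkFine L j.k j.Mn))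
          (pieceS L j.Mn (L ^ j.k) j.k (rweight (d := d) L j.k) j.ν) (fun y y' => β * Real.exp (-(δ * (unitTorusGeoS L j.k j.Mn j.Msz).dist y y')))
      ∧ (∀ μ, HasMaj (BlockNorm.ofBlocks (unitTorusGeoS L j.k j.Mn j.Msz) (blkFine L j.k j.Mn))
          (BlockNorm.ofBlocks (unitTorusGeoS L j.k j.Mn j.Msz) (blkFine L j.k j.Mn))
          (pieceM L j.Mn (L ^ j.k) j.k (rweight (d := d) L j.k) μ j.ν) (fun y y' => β * Real.exp (-(δ * (unitTorusGeoS L j.k j.Mn j.Msz).dist y y'))))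
      ∧ HasMaj (BlockNorm.ofBlocks (unitTorusGeoS L j.k j.Mn j.Msz) (blkFine L j.k j.Mn ∘ kingPrV L j.k j.m j.Mn))
          (BlockNorm.ofBlocks (unitTorusGeoS L j.k j.Mn j.Msz) (blkFine L j.k j.Mn ∘ kingPrV L j.k j.m j.Mn))
          (pieceD3 L j.Mn (L ^ j.m * L ^ j.k) (j.k + j.m) (rweight (d := d) L j.k / ((L : ℝ) ^ j.m) ^ (d + 1)))
          (fun y y' => β * Real.exp (-(δ * (unitTorusGeoS L j.k j.Mn j.Msz).dist y y')))
      ∧ HasMaj (BlockNorm.ofBlocks (unitTorusGeoS L j.k j.Mn j.Msz) (blkFine L j.k j.Mn))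
          (BlockNorm.ofBlocks (unitTorusGeoS L j.k j.Mn j.Msz) (blkFine L j.k j.Mn ∘ kingPrV L j.k j.m j.Mn))
          (idef (pull (kingPrV L j.k j.m j.Mn)) (pull (kingPrV L j.k j.m j.Mn))
            (pieceG L j.Mn (L ^ j.m * L ^ j.k) (j.k + j.m) (rweight (d := d) L j.k / ((L : ℝ) ^ j.m) ^ (d + 1))) (pieceG L j.Mn (L ^ j.k) j.k (rweight (d := d) L j.k)))
          (fun y y' => m₀ * thetaV L j * Real.exp (-(δ * (unitTorusGeoS L j.k j.Mn j.Msz).dist y y')))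
      ∧ (∀ μ, HasMaj (BlockNorm.ofBlocks (unitTorusGeoS L j.k j.Mn j.Msz) (blkFine L j.k j.Mn))
          (BlockNorm.ofBlocks (unitTorusGeoS L j.k j.Mn j.Msz) (blkFine L j.k j.Mn ∘ kingPrV L j.k j.m j.Mn))
          (idef (pull (kingPrV L j.k j.m j.Mn)) (pull (kingPrV L j.k j.m j.Mn))
            (pieceD1 L j.Mn (L ^ j.m * L ^ j.k) (j.k + j.m) (rweight (d := d) L j.k / ((L : ℝ) ^ j.m) ^ (d + 1)) μ)
            (pieceD1 L j.Mn (L ^ j.k) j.k (rweight (d := d) L j.k) μ))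
          (fun y y' => m₀ * thetaV L j * Real.exp (-(δ * (unitTorusGeoS L j.k j.Mn j.Msz).dist y y'))))
      ∧ HasMaj (BlockNorm.ofBlocks (unitTorusGeoS L j.k j.Mn j.Msz) (blkFine L j.k j.Mn))
          (BlockNorm.ofBlocks (unitTorusGeoS L j.k j.Mn j.Msz) (blkFine L j.k j.Mn ∘ kingPrV L j.k j.m j.Mn))
          (idef (pull (kingPrV L j.k j.m j.Mn)) (pull (kingPrV L j.k j.m j.Mn))
            (pieceS L j.Mn (L ^ j.m * L ^ j.k) (j.k + j.m) (rweight (d := d) L j.k / ((L : ℝ) ^ j.m) ^ (d + 1)) j.ν)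
            (pieceS L j.Mn (L ^ j.k) j.k (rweight (d := d) L j.k) j.ν))
          (fun y y' => m₀ * thetaV L j * Real.exp (-(δ * (unitTorusGeoS L j.k j.Mn j.Msz).dist y y')))
      ∧ (∀ μ, HasMaj (BlockNorm.ofBlocks (unitTorusGeoS L j.k j.Mn j.Msz) (blkFine L j.k j.Mn))
          (BlockNorm.ofBlocks (unitTorusGeoS L j.k j.Mn j.Msz) (blkFine L j.k j.Mn ∘ kingPrV L j.k j.m j.Mn))
          (idef (pull (kingPrV L j.k j.m j.Mn)) (pull (kingPrV L j.k j.m j.Mn))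
            (pieceM L j.Mn (L ^ j.m * L ^ j.k) (j.k + j.m) (rweight (d := d) L j.k / ((L : ℝ) ^ j.m) ^ (d + 1)) μ j.ν)
            (pieceM L j.Mn (L ^ j.k) j.k (rweight (d := d) L j.k) μ j.ν))
          (fun y y' => m₀ * thetaV L j * Real.exp (-(δ * (unitTorusGeoS L j.k j.Mn j.Msz).dist y y'))))
      ∧ HasMaj (BlockNorm.ofBlocks (unitTorusGeoS L j.k j.Mn j.Msz) (blkFine L j.k j.Mn))
          (BlockNorm.ofBlocks (unitTorusGeoS L j.k j.Mn j.Msz) (blkFine L j.k j.Mn ∘ kingPrV L j.k j.m j.Mn))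
          (idef (pull (kingPrV L j.k j.m j.Mn)) (pull (kingPrV L j.k j.m j.Mn))
            (pieceD3 L j.Mn (L ^ j.m * L ^ j.k) (j.k + j.m) (rweight (d := d) L j.k / ((L : ℝ) ^ j.m) ^ (d + 1))) (pieceD3 L j.Mn (L ^ j.k) j.k (rweight (d := d) L j.k)))
          (fun y y' => m₀ * thetaV L j * Real.exp (-(δ * (unitTorusGeoS L j.k j.Mn j.Msz).dist y y'))) := by
  -- the zeroth-order layer at its uniform constants (part 27: five plain + four defects), the mixed plain majorants, the per-direction defects
  obtain ⟨β₀, δA, m₁, hβ₀, hδA, hm₁, HA⟩ := uniform_layer_vectorPiece (d := d) (L := L) hd hL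
  obtain ⟨βq, δq, hβq, hδq, HQ⟩ := hasMaj_plainMixed_all (d := d) (L := L) hd hL
  obtain ⟨βp, δp, hβp, hδp, HP⟩ := hasMaj_plain_all (d := d) (L := L) hd hL
  obtain ⟨B₁, δ₁, hB₁, hδ₁, H12⟩ := hasMaj_threeEntries (d := d) (L := L) hd hL (α := 1 / 2) (γ := 1 / 2) (by norm_num) (by norm_num) (by norm_num)
    (by norm_num)
  obtain ⟨B₄, δ₄, hB₄, hδ₄, H4⟩ := hasMaj_mixedEntries (d := d) (L := L) hd hL (α := 1 / 2) (γ := 1 / 2) (by norm_num) (by norm_num) (by norm_num)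
    (by norm_num)
  have hmin : min (1 / 2 : ℝ) (1 / 2) / 2 = 1 / 4 := by norm_num
  rw [hmin] at H12 H4
  set δ : ℝ := min (min δA δq) (min δp (min δ₁ δ₄)) with hδ
  have hδ0 : 0 < δ := lt_min (lt_min hδA hδq) (lt_min hδp (lt_min hδ₁ hδ₄))
  have hδA' : δ ≤ δA := (min_le_left _ _).trans (min_le_left _ _)
  have hδq' : δ ≤ δq := (min_le_left _ _).trans (min_le_right _ _)
  have hδp' : δ ≤ δp := (min_le_right _ _).trans (min_le_left _ _)
  have hδ₁' : δ ≤ δ₁ := (min_le_right _ _).trans ((min_le_right _ _).trans (min_le_left _ _))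
  have hδ₄' : δ ≤ δ₄ := (min_le_right _ _).trans ((min_le_right _ _).trans (min_le_right _ _))
  set β : ℝ := max β₀ (max βq βp) with hβ
  have hβ0 : 0 < β := lt_max_of_lt_left hβ₀
  set m₀ : ℝ := max m₁ (max B₁ B₄) with hm₀
  have hm₀0 : 0 < m₀ := lt_max_of_lt_left hm₁
  refine ⟨β, δ, m₀, hβ0, hδ0, hm₀0, fun j => ?_⟩
  obtain ⟨hG, hG', hS, _, hD3', hDG, _, hDS, hDD3⟩ := HA j
  have hx0 : (0 : ℝ) < (L : ℝ) ^ j.k := pow_pos (by exact_mod_cast (show 0 < L by omega)) _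
  have hθ0 : 0 ≤ thetaV L j := Real.rpow_nonneg hx0.le _
  -- weakening a plain majorant `β'·e^{−δ'd}` (`β' ≤ β`, `δ ≤ δ'`) and a defect majorant `m'·θ·e^{−δ'd}` (`m' ≤ m₀`) to the common letters
  have hplain : ∀ {β' δ' : ℝ}, 0 ≤ β' → β' ≤ β → δ ≤ δ' → ∀ y y' : Tor j.Mn,
      β' * Real.exp (-(δ' * tdistT j.Mn y y')) ≤ β * Real.exp (-(δ * tdistT j.Mn y y')) := fun hβ' hββ hδδ y y' =>
    mul_le_mul hββ (Real.exp_le_exp.mpr (neg_le_neg (mul_le_mul_of_nonneg_right hδδ (tdistT_nonneg _ _ _)))) (Real.exp_nonneg _)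
      (hβ'.trans hββ)
  have hdef : ∀ {m' δ' : ℝ}, 0 ≤ m' → m' ≤ m₀ → δ ≤ δ' → ∀ y y' : Tor j.Mn,
      m' * thetaV L j * Real.exp (-(δ' * tdistT j.Mn y y')) ≤ m₀ * thetaV L j * Real.exp (-(δ * tdistT j.Mn y y')) := fun hm' hmm hδδ y y' =>
    mul_le_mul (mul_le_mul_of_nonneg_right hmm hθ0)
      (Real.exp_le_exp.mpr (neg_le_neg (mul_le_mul_of_nonneg_right hδδ (tdistT_nonneg _ _ _)))) (Real.exp_nonneg _)
      (mul_nonneg (hm'.trans hmm) hθ0)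
  have hrate4 : ∀ {B δ' : ℝ}, 0 ≤ B → B ≤ m₀ → δ ≤ δ' → ∀ y y' : Tor j.Mn,
      B * ((L : ℝ) ^ j.k) ^ (-(1 / 4 : ℝ)) * Real.exp (-(δ' * tdistT j.Mn y y')) ≤ m₀ * thetaV L j * Real.exp (-(δ * tdistT j.Mn y y')) :=
    fun hB hBm hδδ y y' => hdef hB hBm hδδ y y'
  have hβ₀β : β₀ ≤ β := le_max_left _ _
  have hβqβ : βq ≤ β := (le_max_left _ _).trans (le_max_right _ _)
  have hβpβ : βp ≤ β := (le_max_right _ _).trans (le_max_right _ _)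
  have hm₁m : m₁ ≤ m₀ := le_max_left _ _
  have hB₁m : B₁ ≤ m₀ := (le_max_left _ _).trans (le_max_right _ _)
  have hB₄m : B₄ ≤ m₀ := (le_max_right _ _).trans (le_max_right _ _)
  refine ⟨hG.mono (hplain hβ₀.le hβ₀β hδA'), fun μ => ?_, hG'.mono (hplain hβ₀.le hβ₀β hδA'), fun μ => ?_, hS.mono (hplain hβ₀.le hβ₀β hδA'),
    fun μ => ?_, hD3'.mono (hplain hβ₀.le hβ₀β hδA'), hDG.mono (hdef hm₁.le hm₁m hδA'), fun μ => ?_, hDS.mono (hdef hm₁.le hm₁m hδA'), fun μ => ?_,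
    hDD3.mono (hdef hm₁.le hm₁m hδA')⟩
  · -- coarse `∂_μG`: this seat's plain majorant, first conjunct
    exact (HQ j.Mn j.dvd j.k j.m μ j.ν hδ0.le hδq').1.mono (hplain hβq.le hβqβ le_rfl)
  · -- fine `∂′_μG′`: part 26, fourth conjunct at direction `μ`
    exact (HP j.Mn j.dvd j.k j.m μ hδ0.le hδp').2.2.2.1.mono (hplain hβp.le hβpβ le_rfl)
  · -- coarse mixed `∂_μG∂_ν*`: this seat's plain majorant, second conjunct
    exact (HQ j.Mn j.dvd j.k j.m μ j.ν hδ0.le hδq').2.1.mono (hplain hβq.le hβqβ le_rfl)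
  · -- `𝔇(∂′_μG′, ∂_μG)`: part 16's entry 1 at direction `μ` (stated at the rate `δ₁`; weakened to `δ`)
    obtain ⟨_, h₁, _⟩ := H12 j.Mn j.dvd j.k j.m j.one_le μ
    exact h₁.mono (hrate4 hB₁.le hB₁m hδ₁')
  · -- `𝔇(∂′_μG′∂′_ν*, ∂_μG∂_ν*)`: this seat's mixed pair at `(μ, j.ν)`
    exact (H4 j.Mn j.dvd j.k j.m j.one_le μ j.ν hδ0.le hδ₄').mono (hrate4 hB₄.le hB₄m le_rfl)

end Layer

/-! ## §3 THE KNIT: `NE2PlusOperator` BY NAME for the first-order species, background block live, size guard live, every U ≡ 1 input a tree theorem -/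

section Knit

variable {L : ℕ} [NeZero L]

/-- **NE2⁺, OPERATOR LAYER — THE NODE's FIRST CONJUNCT `T4EtaRate.NE2PlusOperator` BY NAME FOR THE U = 1 VECTOR SINGLE-SCALE PIECE DRESSED BY THE FIRST-ORDER
BACKGROUND SPECIES `V = M_c + Σ_μ M_{a_μ}∘∇_μ`**, on the realised family indexed by the sized indices: (3.35) CONSUMED on every coefficient (the carrier's `Reg335`
supplies the sup and oscillation letters of `c′` and of each `a′_μ`, the guard `M·α₀ ≤ a₀` the contraction), the size guard `M₅ ≤ M` LIVE (`bgVecInstance₁_gf_M`,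
unbounded `M`), all four (3.42) entries of the first-order background-dependent pair CONSTRUCTED over the stacked space (n15-b B1–B3), and EVERY U ≡ 1 input — the
twelve hypothesis families of n15-b's B4 `ne2PlusOperator_background₁4`, including the (3.44)-shaped mixed pair — a landed theorem (§2).  B4 instantiated.
[cite: Balaban1985BackgroundPropagators, Thm 3.1 p.397 (quantifier template), (3.35) p.396, (3.42) + (3.44) p.397, (3.52) p.400, (3.63)–(3.65) pp.402–403 (shapes, mechanism); King1986, (4.42)–(4.43) p.675, Prop. 3.9 (3.73) p.665 (A = 0 model, rate factor)] -/
theorem ne2PlusOperator_vectorPiece_background₁ (hd : 1 ≤ d) (hL : 1 ≤ L) (c35 : ℝ) (hc35 : 0 < c35) :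
    NE2PlusOperator c35 (bgVecInstance₁ (d := d) L hL) (bgVecFamily₁4 (d := d) L hL) := by
  obtain ⟨β, δ, m₀, hβ, hδ, hm₀, H⟩ := uniform_layer_firstOrder (d := d) (L := L) hd hL
  have hL0 : L ≠ 0 := by omega
  have hLr : (0 : ℝ) < (L : ℝ) := by exact_mod_cast (show 0 < L by omega)
  have hσ : 0 < δ / 2 := half_pos hδ
  exact ne2PlusOperator_background₁4 (I := VecIndexS d L) (J := Fin (d + 1)) (fun j => unitTorusGeoS L j.k j.Mn j.Msz)
    (fun j => Tor (fine (L ^ j.k) j.Mn) × Fin (d + 1)) (fun j => Tor (fine (L ^ j.m * L ^ j.k) j.Mn) × Fin (d + 1))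
    (fun j => blkFine L j.k j.Mn) (fun j => kingPrV L j.k j.m j.Mn) (fun j => j.m) (fun j => unitTorusGeoS_L_ne_zero L hL j) (thetaV L) (thetaV L)
    (fun j => j.ν)
    (fun j => pieceG L j.Mn (L ^ j.k) j.k (rweight (d := d) L j.k)) (fun j => pieceS L j.Mn (L ^ j.k) j.k (rweight (d := d) L j.k) j.ν)
    (fun j => pieceD3 L j.Mn (L ^ j.k) j.k (rweight (d := d) L j.k))
    (fun j μ => pieceD1 L j.Mn (L ^ j.k) j.k (rweight (d := d) L j.k) μ) (fun j μ => pieceM L j.Mn (L ^ j.k) j.k (rweight (d := d) L j.k) μ j.ν)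
    (fun j => pieceG L j.Mn (L ^ j.m * L ^ j.k) (j.k + j.m) (rweight (d := d) L j.k / ((L : ℝ) ^ j.m) ^ (d + 1)))
    (fun j => pieceS L j.Mn (L ^ j.m * L ^ j.k) (j.k + j.m) (rweight (d := d) L j.k / ((L : ℝ) ^ j.m) ^ (d + 1)) j.ν)
    (fun j => pieceD3 L j.Mn (L ^ j.m * L ^ j.k) (j.k + j.m) (rweight (d := d) L j.k / ((L : ℝ) ^ j.m) ^ (d + 1)))
    (fun j μ => pieceD1 L j.Mn (L ^ j.m * L ^ j.k) (j.k + j.m) (rweight (d := d) L j.k / ((L : ℝ) ^ j.m) ^ (d + 1)) μ)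
    (fun j μ => pieceM L j.Mn (L ^ j.m * L ^ j.k) (j.k + j.m) (rweight (d := d) L j.k / ((L : ℝ) ^ j.m) ^ (d + 1)) μ j.ν)
    c35 hc35 (fun j => triangle254_unitTorusGeo L j.k j.Mn) (fun j a b => tdistT_nonneg _ _ _) hσ.le
    (B4Sect5Proof.latticeConst_nonneg (d + 1) hσ.le) (fun j => rowSum_unitTorusGeo L j.k j.Mn hσ)
    (fun j => inv_pos.mpr (pow_pos hLr _)) (fun j => hLr) (fun j y => (unitTorusGeo_len L j.k j.Mn hL0 y).symm.le)
    (by linarith) hβ.le hm₀.le (by norm_num : (0 : ℝ) < 1 / 4) (fun j => Real.rpow_nonneg (pow_nonneg hLr.le _) _) (fun j y => le_rfl)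
    (fun j => (H j).1) (fun j => (H j).2.1) (fun j => (H j).2.2.1) (fun j => (H j).2.2.2.1) (fun j => (H j).2.2.2.2.1)
    (fun j => (H j).2.2.2.2.2.1) (fun j => (H j).2.2.2.2.2.2.1) (fun j => (H j).2.2.2.2.2.2.2.1) (fun j => (H j).2.2.2.2.2.2.2.2.1)
    (fun j => (H j).2.2.2.2.2.2.2.2.2.1) (fun j => (H j).2.2.2.2.2.2.2.2.2.2.1) (fun j => (H j).2.2.2.2.2.2.2.2.2.2.2)

/-- The four-dimensional instance (`d + 1 = 4`). [cite: Balaban1985BackgroundPropagators, Thm 3.1 p.397 (quantifier template)] -/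
theorem ne2PlusOperator_vectorPiece_background₁_dim4 {L : ℕ} [NeZero L] (hL : 1 ≤ L) (c35 : ℝ) (hc35 : 0 < c35) :
    NE2PlusOperator c35 (bgVecInstance₁ (d := 3) L hL) (bgVecFamily₁4 (d := 3) L hL) :=
  ne2PlusOperator_vectorPiece_background₁ (d := 3) (by norm_num) hL c35 hc35

end Knit

/-! ## §4 THE GAUGE-LIVE KNIT: `NE2PlusOperator` BY NAME with the (abelian) gauge field `A′` LIVE, every U ≡ 1 input a tree theorem -/

section Gauge

variable (L : ℕ) [NeZero L]

/-- THE REALISED GAUGE-FIELD INSTANCE at a sized index: n15-b's `gaugeInstance` (C1; configurations = abelian gauge fields `A′ : Fin (d+1) → X′ → ℝ`, `Reg335` = the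
(3.35) letter pair per component, transport = block average) over the SIZED unit-torus carrier, blocks `blkFine`, King's pairing, scale shift `m`, rate number `θ_j`.
[cite: Balaban1985BackgroundPropagators, Thm 3.14 pp.426–427 (typing template); (3.35) p.396; (3.50)–(3.52) p.400 (the gauge-field species, shape)] -/
def gaugeVecInstance (hL : 1 ≤ L) (j : VecIndexS d L) : PairedInstance :=
  gaugeInstance (Fin (d + 1)) (g := unitTorusGeoS L j.k j.Mn j.Msz) (blkFine L j.k j.Mn) (kingPrV L j.k j.m j.Mn) j.m (unitTorusGeoS_L_ne_zero L hL j)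
    (thetaV L j) (thetaV L j)

/-- THE REALISED GAUGE-FIELD KERNEL FAMILY: n15-b's `gaugeFamily4` (C2: the first-order perturbation DERIVED from `A′` through the exponential species, the pair and
all four (3.42) entries CONSTRUCTED) fed with the -a pieces of the vector single-scale piece at the index (as `bgVecFamily₁4`).
[cite: Balaban1985BackgroundPropagators, (3.42) + (3.44) p.397, (3.50)–(3.52) p.400, (3.63)–(3.65) pp.402–403 (shapes, mechanism)] -/
def gaugeVecFamily4 (hL : 1 ≤ L) (j : VecIndexS d L) : B9.KernelFamily (gaugeVecInstance (d := d) L hL j).gc (gaugeVecInstance (d := d) L hL j).Bf :=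
  gaugeFamily4 (g := unitTorusGeoS L j.k j.Mn j.Msz) (blkFine L j.k j.Mn) (kingPrV L j.k j.m j.Mn) j.m (unitTorusGeoS_L_ne_zero L hL j) (thetaV L j) (thetaV L j)
    j.ν
    (pieceG L j.Mn (L ^ j.k) j.k (rweight (d := d) L j.k)) (pieceS L j.Mn (L ^ j.k) j.k (rweight (d := d) L j.k) j.ν)
    (pieceD3 L j.Mn (L ^ j.k) j.k (rweight (d := d) L j.k))
    (fun μ => pieceD1 L j.Mn (L ^ j.k) j.k (rweight (d := d) L j.k) μ) (fun μ => pieceM L j.Mn (L ^ j.k) j.k (rweight (d := d) L j.k) μ j.ν)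
    (pieceG L j.Mn (L ^ j.m * L ^ j.k) (j.k + j.m) (rweight (d := d) L j.k / ((L : ℝ) ^ j.m) ^ (d + 1)))
    (pieceS L j.Mn (L ^ j.m * L ^ j.k) (j.k + j.m) (rweight (d := d) L j.k / ((L : ℝ) ^ j.m) ^ (d + 1)) j.ν)
    (pieceD3 L j.Mn (L ^ j.m * L ^ j.k) (j.k + j.m) (rweight (d := d) L j.k / ((L : ℝ) ^ j.m) ^ (d + 1)))
    (fun μ => pieceD1 L j.Mn (L ^ j.m * L ^ j.k) (j.k + j.m) (rweight (d := d) L j.k / ((L : ℝ) ^ j.m) ^ (d + 1)) μ)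
    (fun μ => pieceM L j.Mn (L ^ j.m * L ^ j.k) (j.k + j.m) (rweight (d := d) L j.k / ((L : ℝ) ^ j.m) ^ (d + 1)) μ j.ν)

/-- THE GUARD IS LIVE for the gauge-field instance too: its [B9] size parameter IS the index's `M`. [folklore] -/
theorem gaugeVecInstance_gf_M (hL : 1 ≤ L) (j : VecIndexS d L) : (gaugeVecInstance (d := d) L hL j).gf.M = j.Msz := rfl

/-- WHAT (3.35) SAYS HERE for the gauge field: `A′` is `Reg335 c₃₅ α₀`-regular iff every component `A′_μ` is `≤ c₃₅·M·α₀` pointwise with oscillation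
`≤ c₃₅·M·α₀·θ_j` over every King fibre — «|A| < O(1)Mα₀(L^jη)^{−1}, |∇^ηA| < O(1)Mα₀(L^jη)^{−2} on □» read blockwise. [cite: Balaban1985BackgroundPropagators, (3.35) p.396] -/
theorem reg335_gaugeVec_iff (hL : 1 ≤ L) (j : VecIndexS d L) (c35 α₀ : ℝ) (A' : Fin (d + 1) → Tor (fine (L ^ j.m * L ^ j.k) j.Mn) × Fin (d + 1) → ℝ) :
    (gaugeVecInstance (d := d) L hL j).Bf.Reg335 c35 α₀ A' ↔
      (∀ μ x', |A' μ x'| ≤ c35 * j.Msz * α₀) ∧ ∀ μ, FibreOsc (kingPrV L j.k j.m j.Mn) (A' μ) (fun _ => c35 * j.Msz * α₀ * thetaV L j) :=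
  Iff.rfl

variable {L}

/-- **NE2⁺, OPERATOR LAYER — `T4EtaRate.NE2PlusOperator` BY NAME FOR THE U = 1 VECTOR SINGLE-SCALE PIECE WITH THE (ABELIAN) GAUGE FIELD LIVE**: the realised
family over the gauge-field carriers (configurations `A′`, (3.35) CONSUMED on `A′` itself, perturbation `V′ = D_{U′} − ∇′` DERIVED from `A′` by the exponential
species, the pair and all four entries CONSTRUCTED — n15-b C1∕C2), size guard LIVE (`gaugeVecInstance_gf_M`, unbounded `M`), and EVERY U ≡ 1 input a landed
theorem (§2; the rate number `θ_j = (L^k)^{−¼} ≥ η = L^{−k}`, `η ≤ 1`).  n15-b's C2 `ne2PlusOperator_gauge` instantiated.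
[cite: Balaban1985BackgroundPropagators, Thm 3.1 p.397 (quantifier template), (3.35) p.396, (3.42) + (3.44) p.397, (3.50)–(3.52) p.400, (3.63)–(3.65) pp.402–403 (shapes, mechanism); King1986, (4.42)–(4.43) p.675] -/
theorem ne2PlusOperator_vectorPiece_gauge (hd : 1 ≤ d) (hL : 1 ≤ L) (c35 : ℝ) (hc35 : 0 < c35) :
    NE2PlusOperator c35 (gaugeVecInstance (d := d) L hL) (gaugeVecFamily4 (d := d) L hL) := by
  obtain ⟨β, δ, m₀, hβ, hδ, hm₀, H⟩ := uniform_layer_firstOrder (d := d) (L := L) hd hL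
  have hL0 : L ≠ 0 := by omega
  have hLr : (0 : ℝ) < (L : ℝ) := by exact_mod_cast (show 0 < L by omega)
  have hL1 : (1 : ℝ) ≤ (L : ℝ) := by exact_mod_cast hL
  have hσ : 0 < δ / 2 := half_pos hδ
  exact ne2PlusOperator_gauge (I := VecIndexS d L) (J := Fin (d + 1)) (fun j => unitTorusGeoS L j.k j.Mn j.Msz)
    (fun j => Tor (fine (L ^ j.k) j.Mn) × Fin (d + 1)) (fun j => Tor (fine (L ^ j.m * L ^ j.k) j.Mn) × Fin (d + 1))
    (fun j => blkFine L j.k j.Mn) (fun j => kingPrV L j.k j.m j.Mn) (fun j => j.m) (fun j => unitTorusGeoS_L_ne_zero L hL j) (thetaV L) (thetaV L)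
    (fun j => j.ν)
    (fun j => pieceG L j.Mn (L ^ j.k) j.k (rweight (d := d) L j.k)) (fun j => pieceS L j.Mn (L ^ j.k) j.k (rweight (d := d) L j.k) j.ν)
    (fun j => pieceD3 L j.Mn (L ^ j.k) j.k (rweight (d := d) L j.k))
    (fun j μ => pieceD1 L j.Mn (L ^ j.k) j.k (rweight (d := d) L j.k) μ) (fun j μ => pieceM L j.Mn (L ^ j.k) j.k (rweight (d := d) L j.k) μ j.ν)
    (fun j => pieceG L j.Mn (L ^ j.m * L ^ j.k) (j.k + j.m) (rweight (d := d) L j.k / ((L : ℝ) ^ j.m) ^ (d + 1)))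
    (fun j => pieceS L j.Mn (L ^ j.m * L ^ j.k) (j.k + j.m) (rweight (d := d) L j.k / ((L : ℝ) ^ j.m) ^ (d + 1)) j.ν)
    (fun j => pieceD3 L j.Mn (L ^ j.m * L ^ j.k) (j.k + j.m) (rweight (d := d) L j.k / ((L : ℝ) ^ j.m) ^ (d + 1)))
    (fun j μ => pieceD1 L j.Mn (L ^ j.m * L ^ j.k) (j.k + j.m) (rweight (d := d) L j.k / ((L : ℝ) ^ j.m) ^ (d + 1)) μ)
    (fun j μ => pieceM L j.Mn (L ^ j.m * L ^ j.k) (j.k + j.m) (rweight (d := d) L j.k / ((L : ℝ) ^ j.m) ^ (d + 1)) μ j.ν)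
    c35 hc35 (fun j => triangle254_unitTorusGeo L j.k j.Mn) (fun j a b => tdistT_nonneg _ _ _) hσ.le
    (B4Sect5Proof.latticeConst_nonneg (d + 1) hσ.le) (fun j => rowSum_unitTorusGeo L j.k j.Mn hσ)
    (fun j => inv_pos.mpr (pow_pos hLr _)) (fun j => inv_le_one_of_one_le₀ (one_le_pow₀ hL1)) (fun j => inv_pow_le_rpow hL j.k (by norm_num))
    (fun j => hL1) (fun j y => (unitTorusGeo_len L j.k j.Mn hL0 y).symm.le)
    (by linarith) hβ.le hm₀.le (by norm_num : (0 : ℝ) < 1 / 4) (fun j y => le_rfl)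
    (fun j => (H j).1) (fun j => (H j).2.1) (fun j => (H j).2.2.1) (fun j => (H j).2.2.2.1) (fun j => (H j).2.2.2.2.1)
    (fun j => (H j).2.2.2.2.2.1) (fun j => (H j).2.2.2.2.2.2.1) (fun j => (H j).2.2.2.2.2.2.2.1) (fun j => (H j).2.2.2.2.2.2.2.2.1)
    (fun j => (H j).2.2.2.2.2.2.2.2.2.1) (fun j => (H j).2.2.2.2.2.2.2.2.2.2.1) (fun j => (H j).2.2.2.2.2.2.2.2.2.2.2)

/-- The four-dimensional gauge-live instance (`d + 1 = 4`). [cite: Balaban1985BackgroundPropagators, Thm 3.1 p.397 (quantifier template)] -/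
theorem ne2PlusOperator_vectorPiece_gauge_dim4 {L : ℕ} [NeZero L] (hL : 1 ≤ L) (c35 : ℝ) (hc35 : 0 < c35) :
    NE2PlusOperator c35 (gaugeVecInstance (d := 3) L hL) (gaugeVecFamily4 (d := 3) L hL) :=
  ne2PlusOperator_vectorPiece_gauge (d := 3) (by norm_num) hL c35 hc35

end Gauge

end Summit.QuantumFields.YangMills.BalabanUVNodes.N15.VectorPiece

end
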